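import Summits.Ventures.PackingBounds.ThreePointCert.G27CertC

/-!
# A(10, arccos 1/10) ≤ 26: kernel instance of the exact value-27 three-point certificate — kernel validation of sum-of-squares rows (file 7)

Framing: lottery ticket; floor = certified bounds/negative ranges. Venture `PackingBounds` (cell
`pub-packcert`), recognition seat (T5: the ghost `srg(27, 20, 29/2, 15)`), three-point SDP family's exact
kernel format. Integer data of an EXACT (slack-free) Bachoc–Vallentin certificate of value exactly `27` for
`A(10, arccos 1/10)` (n = 10, s = 1/10, degree 6, symmetric sums of squares of Machado–de Oliveira Filho
type, `B = 0`; every block on the optimal face complementary to the ghost pseudo-configuration), produced by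
`pub-packcert-recog` gen 16 (`code/t5/kernel/job3.py` + `job4b.py`, the latter = `pub-packcert-lp` gen 4's
`job4.py` adapted) in the units of the kernel checker `ThreePointCert.CheckExact` (soundness
`ThreePointCert.SoundExact*`, built by `pub-packcert-lp` gen 4 for `A(9, arccos 1/3) ≤ 98`). Generated file:
plain lists of integers / monomials.
-/

namespace Summit.Ventures.PackingBounds.ThreePointCert.G27

open Literature.Geometry.DiscreteGeometry Literature.Geometry.DiscreteGeometry.PolyCert PolyCert.SPoly

set_option maxHeartbeats 0 in
/-- Part `pR2trv`: rows [0, 11) added to `([] : SPoly)` give `d2_1` (kernel; est. 1225 term products). -/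
theorem ok_pR2trv_1 : partChunkOK G27.pR2trv 0 11 ([] : SPoly) G27.d2_1 = true := by
  decide +kernel

set_option maxHeartbeats 0 in
/-- Part `pR2alt`: rows [0, 2) added to `d2_1` give `d2_2` (kernel; est. 144 term products). -/
theorem ok_pR2alt_1 : partChunkOK G27.pR2alt 0 2 G27.d2_1 G27.d2_2 = true := by
  decide +kernel

set_option maxHeartbeats 0 in
/-- Part `pR2std`: rows [0, 11) added to `d2_2` give `eTOT2` (kernel; est. 2312 term products). -/
theorem ok_pR2std_1 : partChunkOK G27.pR2std 0 11 G27.d2_2 G27.eTOT2 = true := by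
  decide +kernel

set_option maxHeartbeats 0 in
/-- Part `pR3trv`: rows [0, 7) added to `([] : SPoly)` give `d3_1` (kernel; est. 400 term products). -/
theorem ok_pR3trv_1 : partChunkOK G27.pR3trv 0 7 ([] : SPoly) G27.d3_1 = true := by
  decide +kernel

set_option maxHeartbeats 0 in
/-- Part `pR3alt`: rows [0, 1) added to `d3_1` give `d3_2` (kernel; est. 36 term products). -/
theorem ok_pR3alt_1 : partChunkOK G27.pR3alt 0 1 G27.d3_1 G27.d3_2 = true := by
  decide +kernel

set_option maxHeartbeats 0 in
/-- Part `pR3std`: rows [0, 6) added to `d3_2` give `eTOT3` (kernel; est. 648 term products). -/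
theorem ok_pR3std_1 : partChunkOK G27.pR3std 0 6 G27.d3_2 G27.eTOT3 = true := by
  decide +kernel

set_option maxHeartbeats 0 in
/-- Part `pR4trv`: rows [0, 11) added to `([] : SPoly)` give `d4_1` (kernel; est. 1225 term products). -/
theorem ok_pR4trv_1 : partChunkOK G27.pR4trv 0 11 ([] : SPoly) G27.d4_1 = true := by
  decide +kernel

set_option maxHeartbeats 0 in
/-- Part `pR4alt`: rows [0, 2) added to `d4_1` give `d4_2` (kernel; est. 144 term products). -/
theorem ok_pR4alt_1 : partChunkOK G27.pR4alt 0 2 G27.d4_1 G27.d4_2 = true := by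
  decide +kernel

set_option maxHeartbeats 0 in
/-- Part `pR4std`: rows [0, 11) added to `d4_2` give `eTOT4` (kernel; est. 2312 term products). -/
theorem ok_pR4std_1 : partChunkOK G27.pR4std 0 11 G27.d4_2 G27.eTOT4 = true := by
  decide +kernel

end Summit.Ventures.PackingBounds.ThreePointCert.G27
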